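import Mathlib
import Literature.MathematicalPhysics.QuantumFieldTheory.Balaban1983to89.B6Ineq268From267
import Literature.MathematicalPhysics.QuantumFieldTheory.Balaban1983to89.B6Lemma21TowerTorus
import Literature.MathematicalPhysics.QuantumFieldTheory.Balaban1983to89.QGQInverse

/-!
# `Balaban1983to89.B6Ineq268OneScaleTorus` — T. Bałaban, *Propagators and renormalization transformations for lattice gauge
theories. II*, Commun. Math. Phys. **96** (1984) 223–250 [Balaban1984PropagatorsII], p. 235: **(2.68) ON THE ONE-SCALE TORUS for the
GENUINE operator `Q′_KG′_K²Q′_K*`, `G′_K = Δ′_a⁻¹ = (−Δ^η + m² + a_KQ′_K*Q′_K)⁻¹`** — the companion `…B6Ineq268From267` ((2.67) ⟹ (2.68)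
end-to-end, members 1–6) instantiated on the one-scale torus family (site version on the tower carriers) of this seat's gen 6
(`…B6Prop22OneScaleTorus`), with EVERY hypothesis of `B6Ineq268From267.line2_of_267` discharged and members 3–6 re-done on one scale, uniformly in the mesh
`η = L^{−K}` and in the volume

statement-level skeleton of published theorems with citation tags; proofs where landed; nothing here is a claim about the Yang–Mills mass gap.
PDF held: `paper:balaban1984-cmp96-propagators-rt-ii` (journal page = PDF page + 222); p. 235 [PDF 13] read this session
(`lit read … --pages 12-13`).

CITATION HEADER (cell `lit-balaban`, HOME `run/shared/lean/pub/lit-balaban/`; Phase-2 proof seat `p01` gen 6 = unit `lit-balaban-p01`;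
`PHASE2-TARGETS.md` §G, G.5-34(d)).  SKELETON row **`B6.Eq2.68`** of `HOME/lit-balaban-r03/ROWS-B6.md` (owner r03, referee ref-4; head
`proved p251013`), Phase-2 kind «model instance» — the one-scale TORUS instance (this seat's gen-4 `…B6Ineq268OneScaleBox` is the degenerate
member K = 0: blocks = sites, Q′ = I).  IMPORTED, NOT MODIFIED: `…B6Ineq268From267` (this seat, gen 4: `line2_of_267` = members 1–3 of (2.68)), `…B6Lemma21TowerTorus`
∕ `…B6Prop22OneScaleTorus` (this seat, gen 6: `oneScaleGeo`, `T1`, `entryB`, `entries_oneScaleTorus` = (2.67) for G′_K on the torus,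
`sum_exp_T1_le`, `T1_triangle`, `T1_nonneg`), `…B6Ineq2142` (r03 g5: `avgOp`, `avgAdj`, `kernelW`), `…B6Ineq268`
(b06-g5: `line2`, `ratio`), `…B1RG242Torus` (`tower`, `Qk_mulVec`, `Qks_mulVec`, `card_Bj`),
`…B5Leaf235Torus` (`blk_eq_proj`), `…B5GpSettingTorus` (`E0_top`, `supNormV`), `…QGQInverse` (`mulVec_single_one_apply`).

WHAT THE PAPER PRINTS (p. 235 [PDF 13], verbatim): *"Let us consider now the operator Q′G′²Q′* and its inverse (Q′G′²Q′*)⁻¹. The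
inequalities (2.67) imply |(Q′G′²Q′*)(y, y′)| = |Σ_{y″∈𝔅} (Q′G′Δ(y″)G′Q′*)(y, y′)| ≤ … ≤ O(1)(L^jη)⁴(L^{j′}η)^{−d} e^{−¼δ₀d(y,y′)}, (2.68)
where we have used the inequalities (2.60), (2.63) of Lemma 1."*; *"⟨λ,λ′⟩ = Σ_{j=0}^k Σ_{y∈Λ_j}(L^jη)^dλ(y)λ′(y). (2.69)"*; *"If we have
one scale, i.e. Λ_k = T₁^{(k)}, then the operator is a unit lattice operator."*

WHAT IS PROVED HERE (0 `sorry`, 0 named facts; axioms standard), on the one-scale torus geometry `oneScaleGeo P Mb R` (unit lattice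
`Site P K`, fine torus `Site P 0`, `L^jη = 1` so `(L^jη)⁴(L^{j′}η)^{−d} ≡ 1`, `d(y,y′) = |y − y′|₁`):
* §1 `avgKer` — the kernel `q(y, x) = L^{−Kd}·[x ∈ B^K(y)]` of `Q′_K` ((2.14)/(1.7)), with `avgKer_support`, `sum_abs_avgKer` (κ₁ = 1),
  `abs_avgKer_le` (κ₂ = 1 at fine weight `w_X = η^d = L^{−Kd}`), and the identifications `avgOp_avgKer` (`avgOp q = Q′_K` =
  `B1RG242Torus.Qk P K`), `avgAdj_avgKer` (`avgAdj w_X (L^jη)^d q = Q′_K*` = `B1RG242Torus.Qks P K`, the block-constant extension);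
* §2 `comp_eq_toLin` (the abstract composite `avgOp q ∘ G ∘ G ∘ avgAdj` IS the matrix `Q′_KG′G′Q′_K*`) and **`kernelW_eq_entry`** — the
  (2.69)-kernel of `Q′G′²Q′*` IS the matrix entry `(Q′_K·G′·G′·Q′_K*)(y, y′)`;
* §3 `line2_oneScale_le` (members 3–6 of (2.68) ON ONE SCALE: the scale ratio is 1 and (2.60) void, so
  `Σ_{y″}e^{−½δ₀d(y,y″)}e^{−½δ₀d(y″,y′)} ≤ c₀(¼)^d e^{−¼δ₀d(y,y′)}` by (2.54) + (2.61) at ¼ — no RM threshold) and **`ineq268_oneScaleTorus`** —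
  the ∃-form over the family: for `d ≥ 1`, odd `L > 1`, `a > 0`, `m² ≥ 0` there are `δ₁, C > 0` (depending on `d, L, a, m²` only) such that for
  EVERY member `i` (every volume, every `K ≥ 1`, `Mb`, `R`) and all `y, y′ ∈ T₁^{(K)}`: `|(Q′_KG′_K²Q′_K*)(y, y′)| ≤ C·e^{−δ₁|y − y′|₁}`,
  `G′_K = (tower P a m²).G K` — members 1–3 = `B6Ineq268From267.line2_of_267` with (2.67)₁ := `entries_oneScaleTorus` (entry 0, block form),
  κ₁ = κ₂ = 1; members 3–6 = `line2_oneScale_le`;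
* `hX_oneScaleTorus` — the same bound in the LITERAL shape of the hypothesis `hX` (power p = 4) of the tree's construction of
  `(Q′G′²Q′*)⁻¹` (`B6Prop27Kernel.inverse_assembled_pow`; cf. the companion's `hX_of_267`), for the genuine (2.69)-kernel
  `kernelW (L^jη)^d (Q′_K ∘ G′_K ∘ G′_K ∘ Q′_K*)`, hypothesis-free on the family.
HONEST SCOPE.  One scale only (the multi-scale content of (2.68) is exercised by the companion's general theorem); scalar model; the
family carries `m² ≥ 0`, `a > 0` (print: m² = 0, a = 1); constants existential (those of `B6Prop22OneScaleTorus.entries_oneScaleTorus`,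
i.e. of [4] Prop. 1.2 for G′_K on the torus), uniform in K ≥ 1, the volume, Mb, R.  Value = the model instance of the companion's implication
for the operator it is about; NOT summit progress.
-/

namespace Literature.MathematicalPhysics.QuantumFieldTheory.Balaban1983to89.B6Ineq268OneScaleTorus

open Finset Matrix
open B6Ineq2142 (avgOp avgAdj kernelW avgOp_apply avgAdj_apply)
open B6Ineq268From267 (line2_of_267)
open B5Ineq137Torus (blk)
open B5GpSettingTorus (supNormV E0_top dir0)
open B1RG242Torus (tower Qk_mulVec Qks_mulVec card_Bj)
open B5Leaf235Torus (blk_eq_proj)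
open B6Prop22OneScaleTorus (T1 oneScaleGeo entryB Index oneScaleGeo_len entryB_zero le_blockSup entries_oneScaleTorus)
open B6Lemma21TowerTorus (T1_triangle T1_nonneg sum_exp_T1_le)

noncomputable section

variable (P : Params)

/-! ## §1. The averaging kernel of `Q′_K` on the tower torus and its identifications -/

/-- The fine weight `w_X = η^d = L^{−Kd}` of the pairing on `T_η` ((1.5) of [4]; here as `(L^{−d})^K`). [cite: Balaban1984PropagatorsII, (2.69) p.235] -/
def wX : ℝ := ((((P.L : ℝ) ^ P.d)⁻¹) ^ P.K)

/-- **The kernel of `Q′_K`**: `q(y, x) = L^{−Kd}` if `x ∈ B^K(y)` and `0` otherwise, so that `(Q′_Kλ)(y) = Σ_x q(y,x)λ(x) =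
L^{−Kd}Σ_{x∈B^K(y)}λ(x)` (`avgOp_avgKer`). [cite: Balaban1984PropagatorsII, (2.14) p.225; Balaban1984PropagatorsI, (1.7) p.18] -/
def avgKer (y : Site P P.K) (x : Site P 0) : ℝ := if blk P P.K x = y then wX P else 0

/-- `0 < w_X`. [folklore] -/
private theorem wX_pos : 0 < wX P := by
  unfold wX
  have := P.cast_L_pos
  positivity

/-- `q(y, x) ≠ 0 ⇒ x ∈ B^K(y)` (hypothesis `hqR` of `line2_of_267`). [cite: Balaban1984PropagatorsII, (2.14) p.225; bookkeeping] -/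
theorem avgKer_support (y : Site P P.K) (x : Site P 0) (h : avgKer P y x ≠ 0) : blk P P.K x = y := by
  by_contra hne
  exact h (if_neg hne)

/-- **κ₁ = 1**: `Σ_x |q(y, x)| = L^{−Kd}·|B^K(y)| = 1` (`B1RG242Torus.card_Bj`: |B^K(y)| = L^{Kd}).
[cite: Balaban1984PropagatorsII, (2.14) p.225; Balaban1987RG1, (0.3) p.252] -/
theorem sum_abs_avgKer (y : Site P P.K) : ∑ x : Site P 0, |avgKer P y x| = 1 := by
  have hK : P.K ≤ P.m + P.K := Nat.le_add_left _ _
  have hw := (wX_pos P).le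
  have h1 : ∀ x : Site P 0, |avgKer P y x| = if Site.proj P.K P.K x = y then wX P else 0 := by
    intro x
    unfold avgKer
    rw [blk_eq_proj hK x]
    split_ifs
    · exact abs_of_nonneg hw
    · exact abs_zero
  simp_rw [h1]
  rw [← Finset.sum_filter, Finset.sum_const, card_Bj hK y, nsmul_eq_mul]
  unfold wX
  have hL : (P.L : ℝ) ^ P.d ≠ 0 := pow_ne_zero _ P.cast_L_pos.ne'
  push_cast
  rw [← pow_mul, mul_comm P.K P.d, pow_mul, ← mul_pow, mul_inv_cancel₀ hL, one_pow]

/-- **κ₂ = 1**: `|q(y, x)| ≤ w_X/(L^jη)^d` with `(L^jη)^d = 1` on one scale (hypothesis `hq2` of `line2_of_267`).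
[cite: Balaban1984PropagatorsII, (2.14) p.225; bookkeeping] -/
theorem abs_avgKer_le (Mb R : ℕ) (y : Site P P.K) (x : Site P 0) :
    |avgKer P y x| ≤ 1 * wX P / (oneScaleGeo P Mb R).len y ^ P.d := by
  rw [oneScaleGeo_len, one_pow, div_one, one_mul]
  unfold avgKer
  split_ifs
  · exact (abs_of_nonneg (wX_pos P).le).le
  · rw [abs_zero]; exact (wX_pos P).le

/-- **`avgOp q = Q′_K`**: the abstract averaging operator of `B6Ineq2142` with the kernel `q` IS the K-fold block average of the tower,
`(Q′_Kλ)(y) = L^{−Kd}Σ_{x∈B^K(y)}λ(x)` (`B1RG242Torus.Qk_mulVec`). [cite: Balaban1984PropagatorsII, (2.14) p.225; Balaban1984PropagatorsI, (1.7) p.18] -/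
theorem avgOp_avgKer (A : Site P 0 → ℝ) (y : Site P P.K) :
    avgOp (avgKer P) A y = (B1RG242Torus.Qk P P.K *ᵥ A) y := by
  have hK : P.K ≤ P.m + P.K := Nat.le_add_left _ _
  have hQ : (B1RG242Torus.Qk P P.K *ᵥ A) y =
      (((P.L : ℝ) ^ P.d)⁻¹) ^ P.K * ∑ x ∈ Finset.univ.filter (fun x : Site P 0 => Site.proj P.K P.K x = y), A x :=
    Qk_mulVec (P := P) 0 0 hK A y
  rw [avgOp_apply, hQ, Finset.mul_sum, Finset.sum_filter]
  refine Finset.sum_congr rfl fun x _ => ?_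
  unfold avgKer wX
  rw [blk_eq_proj hK x]
  split_ifs <;> simp

/-- **`avgAdj w_X (L^jη)^d q = Q′_K*`**: the (2.69)-adjoint of `Q′_K` IS the block-constant extension `(Q′_K*B)(x) = B(y)`, `x ∈ B^K(y)`
(`B1RG242Torus.Qks_mulVec`). [cite: Balaban1984PropagatorsII, p.248 («⟨A, Q*B⟩ = ⟨QA, B⟩»), (2.69) p.235] -/
theorem avgAdj_avgKer (Mb R : ℕ) (B : Site P P.K → ℝ) (x : Site P 0) :
    avgAdj (wX P) (fun z => (oneScaleGeo P Mb R).len z ^ P.d) (avgKer P) B x = (B1RG242Torus.Qks P P.K *ᵥ B) x := by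
  have hK : P.K ≤ P.m + P.K := Nat.le_add_left _ _
  have hQ : (B1RG242Torus.Qks P P.K *ᵥ B) x = B (Site.proj P.K P.K x) := Qks_mulVec (P := P) 0 0 hK B x
  rw [avgAdj_apply, hQ, ← blk_eq_proj hK x]
  have h1 : ∀ b : Site P P.K, (oneScaleGeo P Mb R).len b ^ P.d * avgKer P b x * B b =
      if blk P P.K x = b then wX P * B b else 0 := by
    intro b
    rw [oneScaleGeo_len, one_pow, one_mul]
    unfold avgKer
    split_ifs <;> simp
  simp_rw [h1]
  rw [Finset.sum_ite_eq, if_pos (Finset.mem_univ _), ← mul_assoc, inv_mul_cancel₀ (wX_pos P).ne', one_mul]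

/-! ## §2. The (2.69)-kernel of `Q′G′²Q′*` IS the matrix entry of `Q′_K·G′·G′·Q′_K*` -/

/-- The abstract composite `Q′ ∘ G ∘ G ∘ Q′*` of `B6Ineq268From267` with the torus data IS the linear map of the matrix `Q′_K·G·G·Q′_K*`
(any fine matrix `G`). [cite: Balaban1984PropagatorsII, (2.68) p.235; bookkeeping] -/
theorem comp_eq_toLin (Mb R : ℕ) (G : Matrix (Site P 0) (Site P 0) ℝ) :
    avgOp (avgKer P) ∘ₗ Matrix.toLin' G ∘ₗ Matrix.toLin' G ∘ₗ
        avgAdj (wX P) (fun z => (oneScaleGeo P Mb R).len z ^ P.d) (avgKer P) =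
      Matrix.toLin' (B1RG242Torus.Qk P P.K * G * G * B1RG242Torus.Qks P P.K) := by
  refine LinearMap.ext fun B => funext fun y => ?_
  have hAdj : avgAdj (wX P) (fun z => (oneScaleGeo P Mb R).len z ^ P.d) (avgKer P) B = B1RG242Torus.Qks P P.K *ᵥ B :=
    funext fun x => avgAdj_avgKer P Mb R B x
  have hOp : ∀ A : Site P 0 → ℝ, avgOp (avgKer P) A = B1RG242Torus.Qk P P.K *ᵥ A :=
    fun A => funext fun b => avgOp_avgKer P A b
  rw [LinearMap.comp_apply, LinearMap.comp_apply, LinearMap.comp_apply, hAdj, Matrix.toLin'_apply, Matrix.toLin'_apply,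
    hOp, Matrix.toLin'_apply, Matrix.mulVec_mulVec, Matrix.mulVec_mulVec, Matrix.mulVec_mulVec]

/-- **The (2.69)-kernel of `Q′G′²Q′*` on one scale IS the matrix entry** `(Q′_K·G·G·Q′_K*)(y, y′)` (weights `(L^jη)^d = 1`).
[cite: Balaban1984PropagatorsII, (2.68)–(2.69) p.235] -/
theorem kernelW_eq_entry (Mb R : ℕ) (G : Matrix (Site P 0) (Site P 0) ℝ) (y y' : Site P P.K) :
    kernelW (fun z => (oneScaleGeo P Mb R).len z ^ P.d)
        (avgOp (avgKer P) ∘ₗ Matrix.toLin' G ∘ₗ Matrix.toLin' G ∘ₗ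
          avgAdj (wX P) (fun z => (oneScaleGeo P Mb R).len z ^ P.d) (avgKer P)) y y' =
      (B1RG242Torus.Qk P P.K * G * G * B1RG242Torus.Qks P P.K) y y' := by
  unfold kernelW B6Prop23Chain.mat
  rw [comp_eq_toLin P Mb R G, Matrix.toLin'_apply, QGQInverse.mulVec_single_one_apply]
  beta_reduce
  rw [oneScaleGeo_len, one_pow, div_one]

/-! ## §3. (2.68) on the one-scale torus family for the genuine `Q′_KG′_K²Q′_K*` -/

/-- `|λ| ≤ M` pointwise gives `supNormV (fun _ => λ) ≤ M`. [cite: Balaban1984PropagatorsI, (1.108) p.35; bookkeeping] -/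
private theorem supNormV_const_le {J : Site P 0 → ℝ} {M : ℝ} (hJ : ∀ x, |J x| ≤ M) :
    supNormV P (fun _ : Fin P.d => J) ≤ M := by
  unfold supNormV B5Ineq137Torus.supN
  exact Finset.sup'_le _ _ fun ν _ => Finset.sup'_le _ _ fun x _ => hJ x

/-- **(2.68) lines 2–5 ON ONE SCALE** (members 3–6 of the print collapse): with all sites at scale K the ratio `L^{2(j″−j)}` is 1
and (2.60) is void, so `Σ_{y″} e^{−½δ₀d(y,y″)}e^{−½δ₀d(y″,y′)} ≤ c₀(¼)^d·e^{−¼δ₀d(y,y′)}` by the triangle inequality (2.54) and the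
lattice sum (2.61) at ¼ (`sum_exp_T1_le`) — no threshold on RM is needed on one scale. [cite: Balaban1984PropagatorsII, (2.68) lines 2–5 p.235] -/
theorem line2_oneScale_le (Mb R : ℕ) {δ₀ : ℝ} (hδ₀ : 0 < δ₀) (y y' : Site P P.K) :
    B6Ineq268.line2 (oneScaleGeo P Mb R) δ₀ y y' ≤
      B6.c0 δ₀ (1 / 4) ^ P.d * Real.exp (-(1 / 4 * δ₀ * T1 P P.K y y')) := by
  have hL : (0 : ℝ) < P.L := P.cast_L_pos
  have hratio : ∀ y'' : Site P P.K, B6Ineq268.ratio (oneScaleGeo P Mb R) y y'' = 1 := by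
    intro y''
    unfold B6Ineq268.ratio
    show (P.L : ℝ) ^ (2 * P.K) / (P.L : ℝ) ^ (2 * P.K) = 1
    exact div_self (pow_ne_zero _ hL.ne')
  have hterm : ∀ y'' : Site P P.K,
      B6Ineq268.ratio (oneScaleGeo P Mb R) y y'' * Real.exp (-(1 / 2 * δ₀ * (oneScaleGeo P Mb R).dist y y'')) *
          Real.exp (-(1 / 2 * δ₀ * (oneScaleGeo P Mb R).dist y'' y')) ≤
        Real.exp (-(1 / 4 * δ₀ * T1 P P.K y y')) * Real.exp (-(1 / 4 * δ₀ * T1 P P.K y y'')) := by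
    intro y''
    rw [hratio, one_mul, ← Real.exp_add, ← Real.exp_add]
    apply Real.exp_le_exp.mpr
    show -(1 / 2 * δ₀ * T1 P P.K y y'') + -(1 / 2 * δ₀ * T1 P P.K y'' y') ≤
      -(1 / 4 * δ₀ * T1 P P.K y y') + -(1 / 4 * δ₀ * T1 P P.K y y'')
    have htri := T1_triangle P P.K y y'' y'
    have hB := T1_nonneg P P.K y'' y'
    nlinarith [mul_le_mul_of_nonneg_left htri hδ₀.le, mul_nonneg hδ₀.le hB]
  calc B6Ineq268.line2 (oneScaleGeo P Mb R) δ₀ y y'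
      ≤ ∑ y'' : Site P P.K, Real.exp (-(1 / 4 * δ₀ * T1 P P.K y y')) * Real.exp (-(1 / 4 * δ₀ * T1 P P.K y y'')) :=
        Finset.sum_le_sum fun y'' _ => hterm y''
    _ = Real.exp (-(1 / 4 * δ₀ * T1 P P.K y y')) * ∑ y'' : Site P P.K, Real.exp (-(1 / 4 * δ₀ * T1 P P.K y y'')) := by
        rw [Finset.mul_sum]
    _ ≤ Real.exp (-(1 / 4 * δ₀ * T1 P P.K y y')) * B6.c0 δ₀ (1 / 4) ^ P.d :=
        mul_le_mul_of_nonneg_left (sum_exp_T1_le P P.K (by positivity) y) (Real.exp_pos _).le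
    _ = B6.c0 δ₀ (1 / 4) ^ P.d * Real.exp (-(1 / 4 * δ₀ * T1 P P.K y y')) := mul_comm _ _

/-- **(2.68) ON THE ONE-SCALE TORUS FAMILY FOR THE GENUINE `Q′_KG′_K²Q′_K*`, ∃-form, every hypothesis discharged**: for `d ≥ 1`,
odd `L > 1`, `a > 0`, `m² ≥ 0` there are `δ₁, C > 0` (functions of `d, L, a, m²` only) such that for EVERY member of the family (volume `P`
with `P.d = d`, `P.L = L`, `K = P.K ≥ 1` — mesh `η = L^{−K}` arbitrarily small —, every `Mb`, `R`) and all `y, y′ ∈ T₁^{(K)}`: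
`|(Q′_KG′_K²Q′_K*)(y, y′)| ≤ C·e^{−δ₁|y − y′|₁}`, `G′_K = (B1RG242Torus.tower P a m²).G K = (−Δ^η + m² + a_KQ′_K*Q′_K)⁻¹` — the printed (2.68)
with `(L^jη)⁴(L^{j′}η)^{−d} = 1`, `δ₁ = ¼δ₀`, `C = C²_{(2.67)}c₀(¼)^d`.  Inputs: members 1–3 of the print (`B6Ineq268From267.line2_of_267`)
with (2.67)₁ for G′_K on the torus (`B6Prop22OneScaleTorus.entries_oneScaleTorus`, from [4] Prop. 1.2 ∕ [3]'s Theorem) and κ₁ = κ₂ = 1;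
members 3–6 on one scale = `line2_oneScale_le` ((2.54) + (2.61) at ¼; (2.60) void, no RM threshold). [cite: Balaban1984PropagatorsII, (2.68) p.235] -/
theorem ineq268_oneScaleTorus (d L : ℕ) (hd : 1 ≤ d) (hL : Odd L ∧ 1 < L) {a : ℝ} (ha : 0 < a) {msq : ℝ} (hmsq : 0 ≤ msq) :
    ∃ δ₁ C : ℝ, 0 < δ₁ ∧ 0 < C ∧ ∀ i : Index d L, ∀ y y' : Site i.P i.P.K,
      |(B1RG242Torus.Qk i.P i.P.K * (tower i.P a msq).G i.P.K * (tower i.P a msq).G i.P.K *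
          B1RG242Torus.Qks i.P i.P.K) y y'| ≤ C * Real.exp (-(δ₁ * T1 i.P i.P.K y y')) := by
  classical
  obtain ⟨δ₀, C, Cα, hδ₀, hC, -, h⟩ := entries_oneScaleTorus d L hd hL ha hmsq
  have hc0 : 0 < B6.c0 δ₀ (1 / 4) := by
    -- c₀(¼) ≥ its z = 0 term = 1
    have hs := B6Lemma21Arith.summable_c0_term (show 0 < 1 / 4 * δ₀ by positivity)
    have h1 : Real.exp (-(1 / 4 * δ₀ * |((0 : ℤ) : ℝ)|)) ≤ B6.c0 δ₀ (1 / 4) :=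
      hs.le_tsum 0 fun z _ => (Real.exp_pos _).le
    rw [Int.cast_zero, abs_zero, mul_zero, neg_zero, Real.exp_zero] at h1
    linarith
  refine ⟨δ₀ / 4, C ^ 2 * B6.c0 δ₀ (1 / 4) ^ d, by positivity, by positivity, fun i y y' => ?_⟩
  -- the data of `line2_of_267` on the member `i`
  set g := oneScaleGeo i.P i.Mb i.R with hg
  have hPd : i.P.d = d := i.hPd
  have hη : 0 < g.eta := i.P.eps_pos
  have hgL : 0 < g.L := by show (0 : ℝ) < ((i.P.L : ℕ) : ℝ); exact i.P.cast_L_pos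
  have hwX := wX_pos i.P
  have hqR : ∀ (b : Site i.P i.P.K) (x : Site i.P 0), avgKer i.P b x ≠ 0 → blk i.P i.P.K x = b :=
    fun b x hx => avgKer_support i.P b x hx
  have hq1 : ∀ b : Site i.P i.P.K, ∑ x, |avgKer i.P b x| ≤ 1 := fun b => (sum_abs_avgKer i.P b).le
  have hq2 : ∀ (b : Site i.P i.P.K) (x : Site i.P 0), |avgKer i.P b x| ≤ 1 * wX i.P / g.len b ^ i.P.d :=
    fun b x => abs_avgKer_le i.P i.Mb i.R b x
  -- (2.67)₁ in the shape `h267` of the companion, from the gen-6 torus entries (entry 0, block form)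
  have h267 : ∀ (b b' : Site i.P i.P.K) (J : Site i.P 0 → ℝ) (M : ℝ), (∀ x, J x ≠ 0 → blk i.P i.P.K x = b') →
      (∀ x, |J x| ≤ M) → ∀ x, blk i.P i.P.K x = b →
        |Matrix.toLin' ((tower i.P a msq).G i.P.K) J x| ≤
          C * g.len b ^ 2 * Real.exp (-(1 / 2 * δ₀ * g.dist b b')) * M := by
    intro b b' J M hJ hJM x hx
    have hsupp : ∀ (ν : Fin i.P.d) (z : Site i.P 0), (fun _ : Fin i.P.d => J) ν z ≠ 0 → blk i.P i.P.K z = b' :=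
      fun _ z hz => hJ z hz
    have hent := (h i).1 0 (fun _ => J) b b' hsupp
    rw [entryB_zero] at hent
    have hpt : |Matrix.toLin' ((tower i.P a msq).G i.P.K) J x| ≤
        B6Prop22OneScaleTorus.blockSup i.P i.P.K b (dir0 i.P) (fun μ => B5Display135Torus.E0 i.P a msq i.P.K J) := by
      have hle := le_blockSup (dir0 i.P) (fun _ : Fin i.P.d => B5Display135Torus.E0 i.P a msq i.P.K J) (dir0 i.P) hx
      rw [E0_top] at hle
      rw [Matrix.toLin'_apply]
      exact hle
    have hM : supNormV i.P (fun _ : Fin i.P.d => J) ≤ M := supNormV_const_le i.P hJM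
    have hE : 0 ≤ C * Real.exp (-(δ₀ / 2 * T1 i.P i.P.K b b')) := by positivity
    have hrate : -(δ₀ / 2 * T1 i.P i.P.K b b') = -(1 / 2 * δ₀ * g.dist b b') := by
      show -(δ₀ / 2 * T1 i.P i.P.K b b') = -(1 / 2 * δ₀ * T1 i.P i.P.K b b'); ring
    calc |Matrix.toLin' ((tower i.P a msq).G i.P.K) J x|
        ≤ B6Prop22OneScaleTorus.blockSup i.P i.P.K b (dir0 i.P) (fun μ => B5Display135Torus.E0 i.P a msq i.P.K J) := hpt
      _ ≤ C * Real.exp (-(δ₀ / 2 * T1 i.P i.P.K b b')) * supNormV i.P (fun _ : Fin i.P.d => J) := hent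
      _ ≤ C * Real.exp (-(δ₀ / 2 * T1 i.P i.P.K b b')) * M := mul_le_mul_of_nonneg_left hM hE
      _ = C * g.len b ^ 2 * Real.exp (-(1 / 2 * δ₀ * g.dist b b')) * M := by rw [hrate, oneScaleGeo_len, one_pow, mul_one]
  have key := line2_of_267 g i.P.d (Matrix.toLin' ((tower i.P a msq).G i.P.K)) (avgKer i.P) (blk i.P i.P.K)
    hwX hgL hη hC.le zero_le_one hqR hq1 hq2 h267 y y'
  rw [kernelW_eq_entry i.P i.Mb i.R ((tower i.P a msq).G i.P.K) y y'] at key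
  have hline := line2_oneScale_le i.P i.Mb i.R hδ₀ y y'
  rw [hPd] at hline
  have hlen : g.len y = 1 := oneScaleGeo_len i.P i.Mb i.R y
  have hlen' : g.len y' = 1 := oneScaleGeo_len i.P i.Mb i.R y'
  rw [hlen, hlen', one_pow, one_pow, inv_one, mul_one, mul_one] at key
  calc |(B1RG242Torus.Qk i.P i.P.K * (tower i.P a msq).G i.P.K * (tower i.P a msq).G i.P.K *
          B1RG242Torus.Qks i.P i.P.K) y y'|
      ≤ 1 * 1 * C ^ 2 * B6Ineq268.line2 g δ₀ y y' := key
    _ ≤ 1 * 1 * C ^ 2 * (B6.c0 δ₀ (1 / 4) ^ d * Real.exp (-(1 / 4 * δ₀ * T1 i.P i.P.K y y'))) :=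
        mul_le_mul_of_nonneg_left hline (by positivity)
    _ = C ^ 2 * B6.c0 δ₀ (1 / 4) ^ d * Real.exp (-(δ₀ / 4 * T1 i.P i.P.K y y')) := by ring_nf

/-- **THE (2.68)-INPUT `hX` OF PROPOSITION 2.3's KERNEL CHAIN, ON THE ONE-SCALE TORUS FAMILY, hypothesis-free.**  p. 235: *"Now we will
consider the operator (Q′G′²Q′*)⁻¹ … using again a random walk expansion"* — the tree's construction `B6Prop27Kernel.inverse_assembled_pow`
(power `p = 4`) takes (2.68) as `hX : ∀ y y″, |(L^{j″}η)^d·X(y,y″)| ≤ BX·(L^jη)^4·e^{−½δ·d(y,y″)}` on the (2.69)-kernel `X` of `Q′G′²Q′*`, and the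
companion's `B6Ineq268From267.hX_of_267` derives it from (2.67)₁ under located thresholds.  For the GENUINE
`X = kernelW (L^jη)^d (Q′_K ∘ G′_K ∘ G′_K ∘ Q′_K*)` of the torus tower it HOLDS LITERALLY with NO hypothesis: there are `δ, BX > 0` (functions of
`d, L, a, m²` only; `½δ = δ₁` of `ineq268_oneScaleTorus`) serving every member of the family. [cite: Balaban1984PropagatorsII, (2.68)–(2.69) p.235] -/
theorem hX_oneScaleTorus (d L : ℕ) (hd : 1 ≤ d) (hL : Odd L ∧ 1 < L) {a : ℝ} (ha : 0 < a) {msq : ℝ} (hmsq : 0 ≤ msq) :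
    ∃ δ BX : ℝ, 0 < δ ∧ 0 < BX ∧ ∀ i : Index d L, ∀ y y'' : Site i.P i.P.K,
      |(oneScaleGeo i.P i.Mb i.R).len y'' ^ i.P.d *
          kernelW (fun z => (oneScaleGeo i.P i.Mb i.R).len z ^ i.P.d)
            (avgOp (avgKer i.P) ∘ₗ Matrix.toLin' ((tower i.P a msq).G i.P.K) ∘ₗ
              Matrix.toLin' ((tower i.P a msq).G i.P.K) ∘ₗ
                avgAdj (wX i.P) (fun z => (oneScaleGeo i.P i.Mb i.R).len z ^ i.P.d) (avgKer i.P)) y y''| ≤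
        BX * (oneScaleGeo i.P i.Mb i.R).len y ^ 4 *
          Real.exp (-(1 / 2 * δ * (oneScaleGeo i.P i.Mb i.R).dist y y'')) := by
  obtain ⟨δ₁, C, hδ₁, hC, h⟩ := ineq268_oneScaleTorus d L hd hL ha hmsq
  refine ⟨2 * δ₁, C, by positivity, hC, fun i y y'' => ?_⟩
  rw [kernelW_eq_entry i.P i.Mb i.R ((tower i.P a msq).G i.P.K) y y'', oneScaleGeo_len i.P i.Mb i.R y'',
    oneScaleGeo_len i.P i.Mb i.R y, one_pow, one_pow, one_mul, mul_one]
  have hrate : (1 : ℝ) / 2 * (2 * δ₁) * (oneScaleGeo i.P i.Mb i.R).dist y y'' = δ₁ * T1 i.P i.P.K y y'' := by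
    show (1 : ℝ) / 2 * (2 * δ₁) * T1 i.P i.P.K y y'' = δ₁ * T1 i.P i.P.K y y''
    ring
  rw [hrate]
  exact h i y y''

end

end Literature.MathematicalPhysics.QuantumFieldTheory.Balaban1983to89.B6Ineq268OneScaleTorus
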